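/-
Copyright (c) 2026 the pub-hodgecm-mathlib formalisation cell (harness21).  Prover seat hodgecm-mathlib-F0P3-p02 (g26), 2026-09-03.  E1 row 37 «TRACE OF A BLOCK-PERMUTING
ENDOMORPHISM = SUM OVER THE FIXED BLOCKS» (E1 keeper ∕ dealer F0P3a-p03 (g29) 01:26:59Z).
-/
import Mathlib.Algebra.DirectSum.LinearMap
import Mathlib.LinearAlgebra.FiniteDimensional.Defs
import HarnessLib

/-!
# The trace of an endomorphism permuting the blocks of a direct sum is the sum of the traces on the FIXED blocks

Topic `LinearAlgebra`; declarations in Mathlib's `LinearMap` namespace as a DELIBERATE dot-style extension (lean/CONVENTIONS.md §2) next to Mathlib's `LinearMap.trace_eq_sum_trace_restrict` (all blocks invariant: the block-DIAGONAL case)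
and `LinearMap.trace_eq_zero_of_mapsTo_ne` (a block map with NO fixed block has trace `0`), of which this file is the common generalisation.  THEOREMS ONLY (no definition,
no instance, no notation, no named fact, no `sorry`); Mathlib only; `[DecidableEq ι]` as Mathlib's `DirectSum.IsInternal` wants.  Cell `pub/hodgecm-mathlib` (D-0151), crux H413 = `stmt-HodgeConjecture-24833`, lane `--supports`;
E1 BRICK LEDGER row 37 (keeper F0P3a-p03 (g29) 01:26:59Z): the linear algebra behind «`Tr(g | C_q(Σ)) = Σ_{σ ∈ Σ_q, gσ = σ} ± tr(g | V_σ)`» for the chain modules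
`C_q(Σ) = ⊕_{σ ∈ Σ_q} V^{U_σ}` of a finite convex subcomplex `Σ` of the Bruhat–Tits tree [SchneiderStuhler1997 III.4; MeyerSolleveld2010 §1 p. 4; Korman2004 §4] — an element `g`
stabilising `Σ` PERMUTES the blocks, and only the blocks of the simplices it fixes contribute to the trace.  HONEST LABEL: count-neutral generic base layer; HC_CM is proved
only modulo the 2 remaining named inputs (hLiu418 = `stmt-HodgeConjecture-24832`, h413 = `stmt-HodgeConjecture-24833`) until rung 0 closes.

THE MATHEMATICS.  `M = ⊕_{i ∈ ι} N_i` an internal direct sum of submodules of a finite-dimensional `K`-vector space (`ι` finite), `σ : ι → ι` INJECTIVE (a permutation of the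
blocks), `f ∈ End(M)` with `f(N_i) ⊆ N_{σ i}` for all `i`.  Put `S = {i | σ i = i}`, `P = ⊕_{i ∈ S} N_i`, `Q = ⊕_{i ∉ S} N_i`.  Then `f(P) ⊆ P` (fixed blocks are invariant) and
`f(Q) ⊆ Q` (injectivity: `σ i ≠ i ⇒ σ (σ i) ≠ σ i`), `M = P ⊕ Q`, so `tr f = tr f|_P + tr f|_Q` (Mathlib `trace_eq_sum_trace_restrict` over the two-block decomposition);
`tr f|_P = Σ_{i ∈ S} tr f|_{N_i}` (Mathlib `trace_eq_sum_trace_restrict_of_eq_biSup`) and `tr f|_Q = 0` (Mathlib `trace_eq_zero_of_mapsTo_ne`: on `Q` the block map `σ|_{Sᶜ}` has no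
fixed point).  In matrix terms: a block-permutation matrix has zero diagonal blocks at the moved indices.

* `mapsTo_biSup_fixed_of_mapsTo` ∕ `mapsTo_biSup_moved_of_mapsTo` — `P` and `Q` are `f`-invariant.
* `isCompl_biSup_fixed_biSup_moved` — `M = P ⊕ Q`.
* `trace_restrict_biSup_moved_eq_zero` — `tr f|_Q = 0`.
* **`trace_eq_sum_trace_restrict_fixed_of_mapsTo`** — `tr f = Σ_{i : σ i = i} tr (f|_{N_i})` (the sum over the subtype of fixed indices, the restriction along the user's
  `hfix : ∀ i, σ i = i → MapsTo f (N i) (N i)`).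

## References
* [SchneiderStuhler1997] P. Schneider, U. Stuhler, *Representation theory and sheaves on the Bruhat–Tits building*, Publ. Math. IHÉS 85 (1997): Ch. III §4 (the Euler–Poincaré
  ∕ trace computation on the chain modules of the fixed subcomplex).
* [MeyerSolleveld2010] R. Meyer, M. Solleveld, *Resolutions for representations of reductive p-adic groups via their buildings*, J. reine angew. Math. 647 (2010): §1 p. 4
  (`χ_Σ(g) = Σ_{σ ∈ Σ, gσ = σ} (−1)^{deg σ} χ_{V_σ}(g)`).
* [Korman2004] J. Korman, *A character formula for compact elements (the rank one case)*, arXiv:math/0409292: §4.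
* [Bourbaki1989LieGroups13] N. Bourbaki, *Lie Groups and Lie Algebras, Chapters 1–3*: Ch. I §4 no. 3 Prop. 4 (d) (trace in a basis adapted to a stable decomposition).
-/

set_option autoImplicit false

open Set Function Module
open scoped BigOperators

namespace LinearMap

variable {K : Type*} [Field K] {M : Type*} [AddCommGroup M] [Module K M]
variable {ι : Type*} [DecidableEq ι] {N : ι → Submodule K M} {σ : ι → ι} {f : Module.End K M}

/-! ## §1 The fixed and the moved parts are invariant -/

omit [DecidableEq ι] in
/-- **The sum of the FIXED blocks is invariant**: `f(⊕_{σ i = i} N_i) ⊆ ⊕_{σ i = i} N_i` when `f(N_i) ⊆ N_i` on the fixed blocks.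
[cite: Bourbaki1989LieGroups13, Ch. I §4 no. 3 Prop. 4 (d)] -/
theorem mapsTo_biSup_fixed_of_mapsTo (hfix : ∀ i, σ i = i → MapsTo f (N i) (N i)) :
    MapsTo f ↑(⨆ i ∈ {i | σ i = i}, N i) ↑(⨆ i ∈ {i | σ i = i}, N i) := by
  have h : Submodule.map f (⨆ i ∈ {i | σ i = i}, N i) ≤ ⨆ i ∈ {i | σ i = i}, N i := by
    rw [Submodule.map_iSup]
    refine iSup_le fun i => ?_
    rw [Submodule.map_iSup]
    refine iSup_le fun hi => ?_
    exact (Submodule.map_le_iff_le_comap.mpr (hfix i hi)).trans (le_biSup N hi)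
  exact fun x hx => Submodule.map_le_iff_le_comap.mp h hx

omit [DecidableEq ι] in
/-- **The sum of the MOVED blocks is invariant**: `f(⊕_{σ i ≠ i} N_i) ⊆ ⊕_{σ i ≠ i} N_i` when `f(N_i) ⊆ N_{σ i}` and `σ` is injective (a moved index is sent to a
moved index). [cite: Bourbaki1989LieGroups13, Ch. I §4 no. 3 Prop. 4 (d)] -/
theorem mapsTo_biSup_moved_of_mapsTo (hσ : Injective σ) (hf : ∀ i, MapsTo f (N i) (N (σ i))) :
    MapsTo f ↑(⨆ i ∈ {i | σ i ≠ i}, N i) ↑(⨆ i ∈ {i | σ i ≠ i}, N i) := by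
  have h : Submodule.map f (⨆ i ∈ {i | σ i ≠ i}, N i) ≤ ⨆ i ∈ {i | σ i ≠ i}, N i := by
    rw [Submodule.map_iSup]
    refine iSup_le fun i => ?_
    rw [Submodule.map_iSup]
    refine iSup_le fun hi => ?_
    have hσi : σ (σ i) ≠ σ i := fun h => hi (hσ h)
    exact (Submodule.map_le_iff_le_comap.mpr (hf i)).trans (le_biSup N hσi)
  exact fun x hx => Submodule.map_le_iff_le_comap.mp h hx

/-! ## §2 `M = P ⊕ Q` -/

/-- **`M = (⊕_{σ i = i} N_i) ⊕ (⊕_{σ i ≠ i} N_i)`** for an internal direct sum `M = ⊕_i N_i` over a finite index type. [cite: Bourbaki1989LieGroups13, Ch. I §4 no. 3 Prop. 4 (d)] -/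
theorem isCompl_biSup_fixed_biSup_moved [Finite ι] (h : DirectSum.IsInternal N) :
    IsCompl (⨆ i ∈ {i | σ i = i}, N i) (⨆ i ∈ {i | σ i ≠ i}, N i) := by
  refine ⟨h.submodule_iSupIndep.disjoint_biSup_biSup' (fun s hs ht i hi => (ht hi) (hs hi)) (Set.toFinite _), ?_⟩
  rw [codisjoint_iff, ← iSup_union]
  have hU : ({i | σ i = i} ∪ {i | σ i ≠ i} : Set ι) = Set.univ := by
    ext i; simp [em]
  rw [hU]
  simp [h.submodule_iSup_eq_top]

/-! ## §3 The moved part has trace zero; the trace formula -/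

/-- **`tr f|_Q = 0`** on the sum `Q` of the MOVED blocks: the block map `σ` restricted to `{i | σ i ≠ i}` has no fixed point (Mathlib `trace_eq_zero_of_mapsTo_ne` on `Q` with the
blocks `N_i ∩ Q`). [cite: MeyerSolleveld2010, §1 p. 4] [cite: SchneiderStuhler1997, Ch. III §4] -/
theorem trace_restrict_biSup_moved_eq_zero [FiniteDimensional K M] (h : DirectSum.IsInternal N) (hσ : Injective σ)
    (hf : ∀ i, MapsTo f (N i) (N (σ i))) :
    trace K ↥(⨆ i ∈ {i | σ i ≠ i}, N i) (f.restrict (mapsTo_biSup_moved_of_mapsTo hσ hf)) = 0 := by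
  classical
  set T : Set ι := {i | σ i ≠ i} with hT
  have hind : iSupIndep fun i : T => N i := h.submodule_iSupIndep.comp Subtype.val_injective
  have hint : DirectSum.IsInternal fun i : T => (N i).comap (⨆ i ∈ T, N i).subtype :=
    DirectSum.isInternal_biSup_submodule_of_iSupIndep T hind
  let σ' : T → T := fun i => ⟨σ i, fun h' => i.2 (hσ h')⟩
  have hσ' : ∀ i : T, σ' i ≠ i := fun i h' => i.2 (congrArg Subtype.val h')
  refine trace_eq_zero_of_mapsTo_ne hint σ' hσ' fun i => ?_
  intro x hx
  exact hf i hx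

/-- **THE TRACE OF A BLOCK-PERMUTING ENDOMORPHISM IS THE SUM OF THE TRACES ON THE FIXED BLOCKS.**  `M = ⊕_{i ∈ ι} N_i` internal (`ι` finite, `M` finite-dimensional),
`σ : ι → ι` injective, `f(N_i) ⊆ N_{σ i}`; then `tr f = Σ_{i : σ i = i} tr (f|_{N_i})` (the restrictions along the user's `hfix`).  At `σ = id` this is Mathlib's
`trace_eq_sum_trace_restrict`; when `σ` has no fixed point it is `trace_eq_zero_of_mapsTo_ne`.  Consumer: `Tr(g | ⊕_{σ ∈ Σ_q} V_σ) = Σ_{gσ = σ} tr(g | V_σ)` on the chain modules of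
a finite `g`-stable subcomplex. [cite: MeyerSolleveld2010, §1 p. 4] [cite: SchneiderStuhler1997, Ch. III §4] [cite: Korman2004, §4] -/
theorem trace_eq_sum_trace_restrict_fixed_of_mapsTo [FiniteDimensional K M] [Fintype ι] (h : DirectSum.IsInternal N) (hσ : Injective σ)
    (hf : ∀ i, MapsTo f (N i) (N (σ i))) (hfix : ∀ i, σ i = i → MapsTo f (N i) (N i)) :
    trace K M f = ∑ i : {i // σ i = i}, trace K (N i) (f.restrict (hfix i i.2)) := by
  classical
  set S : Set ι := {i | σ i = i} with hS
  set T : Set ι := {i | σ i ≠ i} with hT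
  set P : Submodule K M := ⨆ i ∈ S, N i with hP
  set Q : Submodule K M := ⨆ i ∈ T, N i with hQ
  have hPf : MapsTo f P P := mapsTo_biSup_fixed_of_mapsTo hfix
  have hQf : MapsTo f Q Q := mapsTo_biSup_moved_of_mapsTo hσ hf
  have hPQ : IsCompl P Q := isCompl_biSup_fixed_biSup_moved h
  -- two-block decomposition `M = P ⊕ Q`
  let B : Bool → Submodule K M := fun b => cond b P Q
  have hB : DirectSum.IsInternal B := by
    rw [DirectSum.isInternal_submodule_iff_isCompl B (i := true) (j := false) (by decide) (by ext b; cases b <;> simp)]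
    exact hPQ
  have hBf : ∀ b, MapsTo f (B b) (B b) := fun b => by cases b <;> assumption
  rw [trace_eq_sum_trace_restrict hB hBf, Fintype.sum_bool]
  change trace K P (f.restrict hPf) + trace K Q (f.restrict hQf) = _
  rw [trace_restrict_biSup_moved_eq_zero h hσ hf, add_zero]
  -- the fixed part, block by block
  have hind : iSupIndep fun i : (Finset.univ : Finset {i // σ i = i}) => N i :=
    h.submodule_iSupIndep.comp (Subtype.val_injective.comp Subtype.val_injective)
  have hP' : P = ⨆ i ∈ (Finset.univ : Finset {i // σ i = i}), N (i : ι) := by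
    rw [hP, hS]
    apply le_antisymm
    · refine iSup_le fun i => iSup_le fun hi => ?_
      exact le_biSup (fun j : {i // σ i = i} => N (j : ι)) (Finset.mem_univ ⟨i, hi⟩)
    · refine iSup_le fun j => iSup_le fun _ => ?_
      exact le_biSup N j.2
  rw [trace_eq_sum_trace_restrict_of_eq_biSup (N := fun j : {i // σ i = i} => N (j : ι)) Finset.univ hind
    (f := f) (fun j => hfix j j.2) P hP' hPf]

end LinearMap
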